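import Literature.NumberTheory.CubicFields.ThreeTorsionMeanBoundNeg
import Literature.NumberTheory.CubicFields.UniformityPerDiscBound
import HarnessLib

/-!
# BTT 2023, Proposition 4.5 (the case `q² ∣ D`) from Hasse's dictionary

`Proofs` file (theorems only), topic `Literature/NumberTheory/CubicFields`.  The uniformity estimate
`btt_uniformity_sqDvd` (`UniformityEstimate.lean`):
`Σ_{0 < ±D < X, q² ∣ D} h(D) = O(6^{ω(q)} X / q²)` for squarefree `q`, proved from the single remaining
named fact of the tree, the form–field dictionary
`threeTorsion_eq_two_mul_cubicFieldCountOfDisc_add_one` (`#Cl(ℚ(√D))[3] = 2·N₃(D) + 1`, Hasse 1930 /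
Davenport–Heilbronn 1971), via `btt_uniformity_sqDvd_of_mean_of_perDisc` (maximal/non-maximal reduction
and field reduction), the class-field-theoretic per-discriminant bound `cubicFieldCountOfDisc_le_threeTorsion`
(`UniformityPerDiscBound`), and Davenport's bounds `O(X)` for classes of binary cubic forms of both signs
(`DavenportBoundPos`, `DavenportBoundNeg`) feeding `mean_threeTorsion_of_dictionary`.  This removes the
Scholz-reflection hypothesis of `btt_uniformity_sqDvd_of_dictionary_of_scholz`.

## References

* M. Bhargava, T. Taniguchi, F. Thorne, *Improved error estimates for the Davenport–Heilbronn theorems*,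
  Math. Ann. 389 (2024), Prop. 4.5 [BhargavaTaniguchiThorne2023].
* K. Belabas, M. Bhargava, C. Pomerance, *Error estimates for the Davenport–Heilbronn theorems*, Duke
  Math. J. 153 (2010), Lemmas 2.2, 3.3, 3.4 [BelabasBhargavaPomerance2010].
-/

noncomputable section

namespace Literature.NumberTheory.CubicFields

open Literature.NumberTheory.QuadraticFields

/-- **BTT 2023, Prop. 4.5, from Hasse's dictionary** (the named fact
`threeTorsion_eq_two_mul_cubicFieldCountOfDisc_add_one`, taken as hypothesis; all other inputs proved).
[cite: BhargavaTaniguchiThorne2023, Prop. 4.5] -/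
theorem btt_uniformity_sqDvd_of_dictionary
    (hdict : threeTorsion_eq_two_mul_cubicFieldCountOfDisc_add_one) : btt_uniformity_sqDvd :=
  btt_uniformity_sqDvd_of_mean_of_perDisc (mean_threeTorsion_of_dictionary_fact hdict)
    cubicFieldCountOfDisc_le_threeTorsion

/-- The same with the dictionary hypothesis unfolded. [cite: BhargavaTaniguchiThorne2023, Prop. 4.5] -/
theorem btt_uniformity_sqDvd_of_dictionary'
    (hdict : ∀ D : ℤ, ((D % 4 = 1 ∧ Squarefree D ∧ D ≠ 1) ∨
      (4 ∣ D ∧ (D / 4 % 4 = 2 ∨ D / 4 % 4 = 3) ∧ Squarefree (D / 4))) →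
      quadFieldThreeTorsion D = 2 * cubicFieldCountOfDisc D + 1) : btt_uniformity_sqDvd :=
  btt_uniformity_sqDvd_of_mean_of_perDisc (mean_threeTorsion_of_dictionary hdict)
    cubicFieldCountOfDisc_le_threeTorsion

end Literature.NumberTheory.CubicFields

end
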